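import Literature.NumberTheory.GaloisRepresentations.ContinuousCohomologyIntCoefficients
import Literature.NumberTheory.GaloisRepresentations.LocalFieldCdTwo
import Literature.NumberTheory.GaloisRepresentations.LocalWeilDatumUnramified
import Literature.AnabelianGeometry.AbsoluteAnabelian.LocalReciprocityCofinal
import Literature.AnabelianGeometry.AbsoluteAnabelian.LocalUnramifiedFieldSubgroups
import Literature.AnabelianGeometry.AbsoluteAnabelian.FundamentalExtension
import HarnessLib

/-!
# `Gal(F^nr/F) ≅ Ẑ` is free procyclic on the Frobenius, and `H²(Gal(F^nr/F), ℤ) ⥲ ℚ/ℤ`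
# (the last arrow of the invariant map of local class field theory)

abc-iut cell, layer L4.  `F` is a non-archimedean local field of characteristic `0`,
`Γ_F = Gal(F̄/F)`, `N = Gal(F̄/F^nr) = galUnr F` (`= absInertia F`, the inertia group; tree
`LocalFieldInertiaCdOne`), `Q = Γ_F ⧸ N = Gal(F^nr/F)`.  [AbsAnab] Prop. 1.2.1 (vii), proof
(kurims p. 11 last paragraph – p. 12 l. 1), the third «group-theoretic» isomorphism of the residue
map: «`H²(Gal(K^unr/K), (K^unr)^×) ⥲ H²(Gal(K^unr/K), ℤ) = H²(Ẑ, ℤ) = ℚ/ℤ` … by (ii), (iii), (iv)»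
(sub-DAG row AbsAnab:Prop1.2.1(vii)/L05′, words-only until now: «`δ : H¹(G_K/I_K, ℚ/ℤ) ⥲
H²(G_K/I_K, ℤ)` (continuous cochains, `ℚ/ℤ` discrete, procyclic quotient) and evaluation at the
Frobenius generator»); the same arrow is [AbsTopIII] Prop. 3.2 (i) p. 71 l. 43–47 «we apply the
isomorphism `G^unr ⥲ Ẑ` … `⥲ H²(Ẑ, ℤ) ⥲ ℚ/ℤ`» (rows P32.i.L04/L05).  This PROOF file supplies it
over the REAL objects of the tree:

* `dense_zpowers_mk_of_isFrobPow` — the image `φ̄ ∈ Q` of any arithmetic Frobenius `φ`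
  (`IsFrobPow φ 1`) generates a DENSE cyclic subgroup of `Q` (every coset of every open normal
  subgroup of `Q` is a power of `φ̄`: tree `exists_pow_eq_mk_quotient`);
* `exists_isOpen_index_quotient_galUnr` — `Q` has an open subgroup of every positive index `n`
  (the image of `Gal(F̄/F_n)`, `F_n` the unramified extension of degree `n`: tree `unramifiedLevel`,
  `fieldSubgroup_unramifiedLevel`, `index_fieldSubgroup_eq`, `index_degMultiples`);
* `isFreeProcyclic_quotient_galUnr` — hence **`Gal(F^nr/F)` is free procyclic** («`G^unr ⥲ Ẑ`»,
  the cell's intrinsic predicate `FundamentalExtension.IsFreeProcyclic`, abc-iut-L4-t1);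
* `mk_eq_mk_of_isFrobPow` — two arithmetic Frobenius lifts have the SAME image in `Q`;
* **`H2UnrEquivQModZ F hφ : H²(Gal(F^nr/F), ℤ) ≃ₗ[ℤ] ℚ/ℤ`**, `[c] ↦ (δ⁻¹[c])(φ̄)` — the trunk's
  `H2IntEquivQModZ` (`ContinuousCohomologyIntCoefficients`: inverse Bockstein
  `δ : H¹(Q, ℚ/ℤ) ⥲ H²(Q, ℤ)`, `H¹ = Hom_cont`, evaluation at a dense generator) at `γ = φ̄`;
  `H2UnrEquivQModZ_eq` — it does NOT depend on the choice of the Frobenius lift;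
  `H2UnrEquivQModZ_symm_apply_eq` — the class with invariant `x` is the Bockstein `δ [χ]` of the
  unique continuous character `χ : Q → ℚ/ℤ` with `χ(φ̄) = x` (the unramified character of
  «invariant» `x`).

Coefficients: the discrete models `ZCoeff = ULift ℤ`, `QModZCoeff = ULift (AddCircle (1 : ℚ))` of
the trunk file (universe of `F`).  What is NOT here: the first two arrows of the printed chain
(`Br(F) = H²(Γ_F, F̄^×) ⥲ H²(Q, (F^unr)^×)` by inflation, and the valuation
`H²(Q, (F^unr)^×) ⥲ H²(Q, ℤ)` — rows L04 and the unit-acyclicity half of L05′ / P32.i.L03–L04),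
which need a field object `F^unr` or its colimit substitute.  HONEST FRAMING: textbook local class
field theory (Serre, *Local Fields* XIII §3); proofs over the tree's definitions; nothing here bears
on [IUTchIII] Cor. 3.12 or takes a side.
-/

noncomputable section

open CategoryTheory Function
open Field IsNonarchimedeanLocalField ValuativeRel IntermediateField

universe u

namespace Literature.AnabelianGeometry.AbsoluteAnabelian

open Literature.NumberTheory.GaloisRepresentations
open Literature.NumberTheory.GaloisRepresentations.IsNonarchimedeanLocalField
open Literature.NumberTheory.GaloisRepresentations.LocalWeilDatum
open _root_.TopRep _root_.ContRepresentation _root_.ContinuousCohomology _root_.Topology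

variable (F : Type u) [Field F] [ValuativeRel F] [TopologicalSpace F] [IsNonarchimedeanLocalField F]

/-! ### `Q = Γ_F / Gal(F̄/F^nr)` is profinite, topologically generated by the Frobenius -/

/-- `Gal(F^nr/F) = Γ_F ⧸ galUnr F` is compact (instance: the trunk keeps `CompactSpace Γ_F` as the
theorem `absoluteGaloisGroup_compactSpace`; the quotient by `galUnr F` is registered here so that the
profinite hypotheses of the Bockstein files are found by instance resolution).
[cite: MochizukiAbsAnab2004, Prop 1.2.1 (vii) proof p.11] -/
instance compactSpace_quotient_galUnr : CompactSpace (absoluteGaloisGroup F ⧸ galUnr F) := by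
  haveI := absoluteGaloisGroup_compactSpace F
  infer_instance

/-- `Gal(F^nr/F) = Γ_F ⧸ galUnr F` is totally disconnected (`galUnr F` is closed; instance).
[cite: MochizukiAbsAnab2004, Prop 1.2.1 (vii) proof p.11] -/
instance totallyDisconnectedSpace_quotient_galUnr :
    TotallyDisconnectedSpace (absoluteGaloisGroup F ⧸ galUnr F) := by
  haveI := absoluteGaloisGroup_compactSpace F
  exact QuotientGroup.totallyDisconnectedSpace_of_isClosed (galUnr F) (isClosed_galUnr F)

/-- `Gal(F^nr/F)` is Hausdorff (instance). [cite: MochizukiAbsAnab2004, Prop 1.2.1 (vii) proof p.11] -/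
instance t2Space_quotient_galUnr : T2Space (absoluteGaloisGroup F ⧸ galUnr F) := by
  infer_instance

variable {F} in
/-- **Two Frobenius powers of the same exponent have the same image in `Gal(F^nr/F)`** (they differ
by an element of inertia); in particular all arithmetic Frobenius lifts (`IsFrobPow · 1`) have the
same image `φ̄`. [cite: MochizukiAbsAnab2004, Prop 1.2.1 (iv) p.10] -/
theorem mk_eq_mk_of_isFrobPow {φ φ' : absoluteGaloisGroup F} {n : ℤ} (hφ : IsFrobPow φ n)
    (hφ' : IsFrobPow φ' n) :
    (QuotientGroup.mk φ : absoluteGaloisGroup F ⧸ galUnr F) = QuotientGroup.mk φ' := by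
  rw [QuotientGroup.eq_iff_div_mem, div_eq_mul_inv]
  exact absInertia_le_galUnr F (IsFrobPow.mul_inv_mem_absInertia_holds hφ hφ')

variable {F} in
/-- The image in `Gal(F^nr/F)` of a Frobenius power of exponent `k : ℕ` is `φ̄ ^ k`.
[cite: MochizukiAbsAnab2004, Prop 1.2.1 (iv) p.10] -/
theorem mk_eq_mk_pow_of_isFrobPow {φ σ : absoluteGaloisGroup F} (hφ : IsFrobPow φ 1) {k : ℕ}
    (hσ : IsFrobPow σ (k : ℤ)) :
    (QuotientGroup.mk σ : absoluteGaloisGroup F ⧸ galUnr F) = (QuotientGroup.mk φ) ^ k := by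
  rw [← QuotientGroup.mk_pow]
  exact mk_eq_mk_of_isFrobPow hσ (isFrobPow_pow hφ k)

variable {F} in
/-- **The Frobenius topologically generates `Gal(F^nr/F)`**: for any `φ ∈ Γ_F` with `IsFrobPow φ 1`,
the cyclic subgroup generated by its image `φ̄` is dense in `Q = Γ_F ⧸ galUnr F` (every coset of
every open normal subgroup of the profinite group `Q` is a power of `φ̄`, tree
`exists_pow_eq_mk_quotient`). [cite: MochizukiAbsAnab2004, Prop 1.2.1 (iv) p.10] -/
theorem dense_zpowers_mk_of_isFrobPow {φ : absoluteGaloisGroup F} (hφ : IsFrobPow φ 1) :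
    Dense (Subgroup.zpowers (QuotientGroup.mk φ : absoluteGaloisGroup F ⧸ galUnr F) :
      Set (absoluteGaloisGroup F ⧸ galUnr F)) := by
  set Q := absoluteGaloisGroup F ⧸ galUnr F
  rw [dense_iff_inter_open]
  rintro U hU ⟨q, hq⟩
  -- an open normal subgroup `H` of `Q` with `q · H ⊆ U`
  have h1 : (1 : Q) ∈ (fun h : Q => q * h) ⁻¹' U := by
    change q * 1 ∈ U
    rwa [mul_one]
  obtain ⟨H, hH⟩ := ProfiniteGrp.exist_openNormalSubgroup_sub_open_nhds_of_one
    (hU.preimage (continuous_const.mul continuous_id)) h1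
  -- `q ≡ φ̄ ^ i (mod H)` for some `i`
  obtain ⟨i, hi⟩ := exists_pow_eq_mk_quotient F (H : Subgroup Q) H.isOpen' hφ (QuotientGroup.mk q)
  rw [← QuotientGroup.mk_pow, QuotientGroup.eq] at hi
  -- hence `φ̄ ^ i = q * h ∈ q · H ⊆ U`
  refine ⟨(QuotientGroup.mk φ : Q) ^ i, ?_, ⟨i, by simp⟩⟩
  have hmem : q * (q⁻¹ * (QuotientGroup.mk φ : Q) ^ i) ∈ U := hH hi
  rwa [mul_inv_cancel_left] at hmem

/-- **`Gal(F^nr/F)` has an open subgroup of every positive index `n`**: the image of `Gal(F̄/F_n)`,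
`F_n` the unramified extension of degree `n` (`unramifiedLevel F n`), whose fixing group contains the
inertia group and has index `[F_n : F] = n`. [cite: MochizukiAbsAnab2004, Prop 1.2.1 (ii) proof p.11] -/
theorem exists_isOpen_index_quotient_galUnr (n : ℕ) (hn : 0 < n) :
    ∃ H : Subgroup (absoluteGaloisGroup F ⧸ galUnr F),
      IsOpen (H : Set (absoluteGaloisGroup F ⧸ galUnr F)) ∧ H.index = n := by
  haveI := (unramifiedLevel_finite_abelian_unramified F hn).1
  let U : Subgroup (absoluteGaloisGroup F) := galFixing F (unramifiedLevel F n)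
  have hUidx : U.index = n := by
    have hDm : ∀ v : WeilGroup F, v ∈ AbstractCFT.degMultiples (degHom F) n ↔
        (n : ℤ) ∣ WeilGroup.deg v := fun v => by
      rw [AbstractCFT.mem_degMultiples_iff, degZ_degHom]
    rw [← index_fieldSubgroup_eq, fieldSubgroup_unramifiedLevel F hn]
    exact index_degMultiples hn _ hDm
  refine ⟨U.map (QuotientGroup.mk' (galUnr F)), ?_, ?_⟩
  · exact QuotientGroup.isOpenMap_coe _ (isOpen_galFixing F (unramifiedLevel F n))
  · rw [Subgroup.index_map_eq _ (QuotientGroup.mk'_surjective _)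
      (by rw [QuotientGroup.ker_mk']; exact galUnr_le_galFixing_unramifiedLevel F hn)]
    exact hUidx

/-- **`Gal(F^nr/F) ≅ Ẑ`**: the quotient `Γ_F ⧸ Gal(F̄/F^nr)` is free procyclic in the sense of the
cell's intrinsic predicate (dense cyclic subgroup + an open subgroup of every positive index) —
«the quotient `G_K ↠ G^unr` … `G^unr ⥲ Ẑ`». [cite: MochizukiAbsAnab2004, Prop 1.2.1 (iv) p.10] -/
theorem isFreeProcyclic_quotient_galUnr :
    FundamentalExtension.IsFreeProcyclic (absoluteGaloisGroup F ⧸ galUnr F) := by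
  obtain ⟨φ, hφ⟩ := exists_isFrobPow_holds (F := F) 1
  exact ⟨⟨_, dense_zpowers_mk_of_isFrobPow hφ⟩, exists_isOpen_index_quotient_galUnr F⟩

/-! ### `H²(Gal(F^nr/F), ℤ) ⥲ ℚ/ℤ` through the Frobenius -/

variable {F} in
/-- **`H²(Gal(F^nr/F), ℤ) ⥲ ℚ/ℤ`, `[c] ↦ (δ⁻¹[c])(φ̄)`** for an arithmetic Frobenius `φ`
(`IsFrobPow φ 1`): the composite «`H²(Ẑ, ℤ) ⥲ H¹(Ẑ, ℚ/ℤ) = Hom(Ẑ, ℚ/ℤ) → ℚ/ℤ`, evaluation at the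
Frobenius» through which the residue map `inv_F : Br(F) → ℚ/ℤ` is defined — the trunk's
`H2IntEquivQModZ` (inverse continuous Bockstein of `0 → ℤ → ℚ → ℚ/ℤ → 0`, `H¹ = Hom_cont` for the
trivial action, evaluation at the dense generator `φ̄` of the profinite group `Q = Γ_F ⧸ galUnr F`).
[cite: MochizukiAbsAnab2004, Prop 1.2.1 (vii) proof p.11] -/
def H2UnrEquivQModZ {φ : absoluteGaloisGroup F} (hφ : IsFrobPow φ 1) :
    continuousCohomology 2
        (ContinuousRep.trivial (absoluteGaloisGroup F ⧸ galUnr F) ℤ ZCoeff.{u}).toTopRep ≃ₗ[ℤ]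
      QModZCoeff.{u} :=
  H2IntEquivQModZ (dense_zpowers_mk_of_isFrobPow hφ) (exists_isOpen_index_quotient_galUnr F)

variable {F} in
/-- `H2UnrEquivQModZ hφ z = (H2IntEquivHom Q z)(φ̄)`: the invariant of a class is the value at the
Frobenius of the continuous character `Q → ℚ/ℤ` whose Bockstein it is.
[cite: MochizukiAbsAnab2004, Prop 1.2.1 (vii) proof p.11] -/
theorem H2UnrEquivQModZ_apply {φ : absoluteGaloisGroup F} (hφ : IsFrobPow φ 1)
    (z : continuousCohomology 2
      (ContinuousRep.trivial (absoluteGaloisGroup F ⧸ galUnr F) ℤ ZCoeff.{u}).toTopRep) :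
    H2UnrEquivQModZ hφ z =
      (H2IntEquivHom (absoluteGaloisGroup F ⧸ galUnr F) z).1 (QuotientGroup.mk φ) :=
  rfl

variable {F} in
/-- **Independence of the Frobenius lift**: `H2UnrEquivQModZ` is the same map for any two `φ, φ'`
with `IsFrobPow · 1` (their images in `Gal(F^nr/F)` coincide).
[cite: MochizukiAbsAnab2004, Prop 1.2.1 (vii) proof p.11] -/
theorem H2UnrEquivQModZ_eq {φ φ' : absoluteGaloisGroup F} (hφ : IsFrobPow φ 1)
    (hφ' : IsFrobPow φ' 1) : H2UnrEquivQModZ hφ = H2UnrEquivQModZ hφ' := by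
  have key : ∀ {γ γ' : absoluteGaloisGroup F ⧸ galUnr F} (_ : γ = γ')
      (hγ : Dense (Subgroup.zpowers γ : Set (absoluteGaloisGroup F ⧸ galUnr F)))
      (hγ' : Dense (Subgroup.zpowers γ' : Set (absoluteGaloisGroup F ⧸ galUnr F))),
      H2IntEquivQModZ hγ (exists_isOpen_index_quotient_galUnr F) =
        H2IntEquivQModZ hγ' (exists_isOpen_index_quotient_galUnr F) := by
    intro γ γ' e hγ hγ'
    subst e
    rfl
  exact key (mk_eq_mk_of_isFrobPow hφ hφ') _ _

variable {F} in
/-- **The inverse**: `(H2UnrEquivQModZ hφ)⁻¹ x = δ [χ]` for every continuous character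
`χ : Gal(F^nr/F) → ℚ/ℤ` with `χ(φ̄) = x` — the class of `H²(Gal(F^nr/F), ℤ)` with invariant `x` is
the Bockstein of the unramified character taking the value `x` at the Frobenius.
[cite: MochizukiAbsAnab2004, Prop 1.2.1 (vii) proof p.11] -/
theorem H2UnrEquivQModZ_symm_apply_eq {φ : absoluteGaloisGroup F} (hφ : IsFrobPow φ 1)
    (x : QModZCoeff.{u})
    (χ : contOneCocycles
      (ContinuousRep.trivial (absoluteGaloisGroup F ⧸ galUnr F) ℤ QModZCoeff.{u}).toTopRep)
    (hχ : χ.1 (QuotientGroup.mk φ) = x) :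
    (H2UnrEquivQModZ hφ).symm x =
      (isSES_ZQ (absoluteGaloisGroup F ⧸ galUnr F)).δ₁ (oneCocycleClass _ χ) := by
  exact H2IntEquivQModZ_symm_apply_eq (dense_zpowers_mk_of_isFrobPow hφ)
    (exists_isOpen_index_quotient_galUnr F) x χ hχ

variable {F} in
/-- For every `x ∈ ℚ/ℤ` there is exactly one continuous character `χ : Gal(F^nr/F) → ℚ/ℤ` with
`χ(φ̄) = x` (the unramified character of invariant `x`).
[cite: MochizukiAbsAnab2004, Prop 1.2.1 (vii) proof p.11] -/
theorem existsUnique_unramifiedCharacter_apply_eq {φ : absoluteGaloisGroup F} (hφ : IsFrobPow φ 1)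
    (x : QModZCoeff.{u}) :
    ∃! χ : contOneCocycles
        (ContinuousRep.trivial (absoluteGaloisGroup F ⧸ galUnr F) ℤ QModZCoeff.{u}).toTopRep,
      χ.1 (QuotientGroup.mk φ) = x := by
  exact existsUnique_character_apply_eq (dense_zpowers_mk_of_isFrobPow hφ)
    (exists_isOpen_index_quotient_galUnr F) x

end Literature.AnabelianGeometry.AbsoluteAnabelian

end
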